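import Literature.NumberTheory.Transcendental.ComplexFormsPullback
import Literature.NumberTheory.Transcendental.DeRhamTheorem
import Literature.Geometry.Kaehler.ManifoldFormsPullback
import Mathlib.Geometry.Manifold.Diffeomorph
import HarnessLib

/-!
# The pull-back on complex de Rham cohomology along a diffeomorphism is invertible

Layer `Literature/Geometry/Kaehler`; theorems only, no definition, no named fact.  Prover seat `hodge-nonav-19716-p2` (g11,
cell `hodge-nonav`): brick **K1-1** of prover-Bx's programme «GRIFFITHS-HOLOMORPHY» (memo §3: «if the tree has no packaged
`complexDeRhamCohomology` equiv for a `Diffeomorph`, … export the lemma `map (e z) ∘ map (e z).symm = id` you use»),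
`--supports stmt-HodgeConjecture-19716`.  For a `C^∞` diffeomorphism `Φ : M ≃ₘ M'` of real manifolds (complex model spaces
`E`, `E'`; the pull-back calculus is the tree's global instance `instPullbackFacts`):

* `complexDeRhamCohomology.map_symm_comp_map`, `…map_comp_map_symm` — `(Φ⁻¹)^* ∘ Φ^* = id`, `Φ^* ∘ (Φ⁻¹)^* = id`
  (functoriality `map_comp`, `map_id`);
* `complexDeRhamCohomology.map_symm_apply_map`, `…map_apply_map_symm` — pointwise forms;
* `complexDeRhamCohomology.map_diffeomorph_bijective` / `…_injective` / `…_surjective`;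
* `complexDeRhamCohomology.map_trans` — for `Ψ = Φ₁.symm.trans Φ₂ : M₁ → M₂`, `Ψ^* ∘ (Φ₂⁻¹)^* = (Φ₁⁻¹)^*` as maps
  `H^k(M₀) → H^k(M₁)` (the class identity behind «`Ψ^*η₂ − η₁` is exact» for representatives of one transported class).

HONEST FRAMING: bookkeeping; nothing here says HC or any rung is proved.

## References
* [BottTu1982Forms] R. Bott, L. Tu, Differential Forms in Algebraic Topology (1982), §I.2 (functoriality of de Rham cohomology).
* [LeeSmoothManifolds2013] J. M. Lee, Introduction to Smooth Manifolds (2013), Thm. 17.8 / Cor. 17.9 (diffeomorphism invariance).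
-/

noncomputable section

open scoped Manifold ContDiff

namespace Literature.Geometry.Kaehler

open Literature.NumberTheory.Transcendental

universe u₁ u₂ u₃ u₄ u₅ u₆

variable {E : Type u₁} [NormedAddCommGroup E] [NormedSpace ℂ E]
  {E' : Type u₂} [NormedAddCommGroup E'] [NormedSpace ℂ E']
  {E'' : Type u₅} [NormedAddCommGroup E''] [NormedSpace ℂ E'']
  {M : Type u₃} [TopologicalSpace M] [ChartedSpace E M] [IsManifold 𝓘(ℝ, E) ∞ M]
  {M' : Type u₄} [TopologicalSpace M'] [ChartedSpace E' M'] [IsManifold 𝓘(ℝ, E') ∞ M']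
  {M'' : Type u₆} [TopologicalSpace M''] [ChartedSpace E'' M''] [IsManifold 𝓘(ℝ, E'') ∞ M'']

/-- **`(Φ⁻¹)^* ∘ Φ^* = id` on `H^k_dR(M'; ℂ)`** for a diffeomorphism `Φ : M ≃ M'` (functoriality of de Rham cohomology;
diffeomorphism invariance). [cite: BottTu1982Forms, §I.2] [cite: LeeSmoothManifolds2013, Cor. 17.9] -/
theorem complexDeRhamCohomology.map_symm_comp_map (Φ : Diffeomorph 𝓘(ℝ, E) 𝓘(ℝ, E') M M' ∞) (k : ℕ) :
    complexDeRhamCohomology.map E' Φ.symm.contMDiff k ∘ₗ complexDeRhamCohomology.map E Φ.contMDiff k = LinearMap.id := by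
  rw [← complexDeRhamCohomology.map_comp Φ.contMDiff Φ.symm.contMDiff k]
  have h : ((Φ : M → M') ∘ (Φ.symm : M' → M)) = id := funext fun y ↦ Φ.apply_symm_apply y
  rw [complexDeRhamCohomology.map_congr (Φ.contMDiff.comp Φ.symm.contMDiff) contMDiff_id h k,
    complexDeRhamCohomology.map_id]

/-- **`Φ^* ∘ (Φ⁻¹)^* = id` on `H^k_dR(M; ℂ)`.** [cite: BottTu1982Forms, §I.2] [cite: LeeSmoothManifolds2013, Cor. 17.9] -/
theorem complexDeRhamCohomology.map_comp_map_symm (Φ : Diffeomorph 𝓘(ℝ, E) 𝓘(ℝ, E') M M' ∞) (k : ℕ) :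
    complexDeRhamCohomology.map E Φ.contMDiff k ∘ₗ complexDeRhamCohomology.map E' Φ.symm.contMDiff k = LinearMap.id :=
  complexDeRhamCohomology.map_symm_comp_map Φ.symm k

/-- Pointwise: `(Φ⁻¹)^* (Φ^* c) = c`. [cite: BottTu1982Forms, §I.2] -/
theorem complexDeRhamCohomology.map_symm_apply_map (Φ : Diffeomorph 𝓘(ℝ, E) 𝓘(ℝ, E') M M' ∞) (k : ℕ)
    (c : complexDeRhamCohomology E' M' k) :
    complexDeRhamCohomology.map E' Φ.symm.contMDiff k (complexDeRhamCohomology.map E Φ.contMDiff k c) = c := by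
  have h := LinearMap.congr_fun (complexDeRhamCohomology.map_symm_comp_map Φ k) c
  simpa using h

/-- Pointwise: `Φ^* ((Φ⁻¹)^* c) = c`. [cite: BottTu1982Forms, §I.2] -/
theorem complexDeRhamCohomology.map_apply_map_symm (Φ : Diffeomorph 𝓘(ℝ, E) 𝓘(ℝ, E') M M' ∞) (k : ℕ)
    (c : complexDeRhamCohomology E M k) :
    complexDeRhamCohomology.map E Φ.contMDiff k (complexDeRhamCohomology.map E' Φ.symm.contMDiff k c) = c :=
  complexDeRhamCohomology.map_symm_apply_map Φ.symm k c

/-- **`Φ^*` is bijective on complex de Rham cohomology** for a diffeomorphism `Φ`. [cite: LeeSmoothManifolds2013, Cor. 17.9] -/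
theorem complexDeRhamCohomology.map_diffeomorph_bijective (Φ : Diffeomorph 𝓘(ℝ, E) 𝓘(ℝ, E') M M' ∞) (k : ℕ) :
    Function.Bijective (complexDeRhamCohomology.map E Φ.contMDiff k) :=
  ⟨fun a b hab ↦ by
      have h := congrArg (complexDeRhamCohomology.map E' Φ.symm.contMDiff k) hab
      rwa [complexDeRhamCohomology.map_symm_apply_map, complexDeRhamCohomology.map_symm_apply_map] at h,
    fun c ↦ ⟨complexDeRhamCohomology.map E' Φ.symm.contMDiff k c, complexDeRhamCohomology.map_apply_map_symm Φ k c⟩⟩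

/-- `Φ^*` is injective on complex de Rham cohomology. [cite: LeeSmoothManifolds2013, Cor. 17.9] -/
theorem complexDeRhamCohomology.map_diffeomorph_injective (Φ : Diffeomorph 𝓘(ℝ, E) 𝓘(ℝ, E') M M' ∞) (k : ℕ) :
    Function.Injective (complexDeRhamCohomology.map E Φ.contMDiff k) :=
  (complexDeRhamCohomology.map_diffeomorph_bijective Φ k).1

/-- `Φ^*` is surjective on complex de Rham cohomology. [cite: LeeSmoothManifolds2013, Cor. 17.9] -/
theorem complexDeRhamCohomology.map_diffeomorph_surjective (Φ : Diffeomorph 𝓘(ℝ, E) 𝓘(ℝ, E') M M' ∞) (k : ℕ) :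
    Function.Surjective (complexDeRhamCohomology.map E Φ.contMDiff k) :=
  (complexDeRhamCohomology.map_diffeomorph_bijective Φ k).2

/-- **Transition along a common reference.** For diffeomorphisms `Φ₁ : M ≃ M'`, `Φ₂ : M ≃ M''` and `Ψ = Φ₁⁻¹ ≫ Φ₂ : M' → M''`:
`Ψ^* ∘ (Φ₂⁻¹)^* = (Φ₁⁻¹)^*` on `H^k_dR(M; ℂ)` — two representatives of the transports of ONE class of the reference `M` differ,
after pull-back along `Ψ`, by an exact form. [cite: BottTu1982Forms, §I.2] -/
theorem complexDeRhamCohomology.map_trans_comp_map_symm (Φ₁ : Diffeomorph 𝓘(ℝ, E) 𝓘(ℝ, E') M M' ∞)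
    (Φ₂ : Diffeomorph 𝓘(ℝ, E) 𝓘(ℝ, E'') M M'' ∞) (k : ℕ) :
    complexDeRhamCohomology.map E' (Φ₁.symm.trans Φ₂).contMDiff k ∘ₗ complexDeRhamCohomology.map E'' Φ₂.symm.contMDiff k =
      complexDeRhamCohomology.map E' Φ₁.symm.contMDiff k := by
  rw [← complexDeRhamCohomology.map_comp Φ₂.symm.contMDiff (Φ₁.symm.trans Φ₂).contMDiff k]
  have h : ((Φ₂.symm : M'' → M) ∘ ((Φ₁.symm.trans Φ₂) : M' → M'')) = (Φ₁.symm : M' → M) := by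
    funext y
    simp [Diffeomorph.coe_trans]
  exact complexDeRhamCohomology.map_congr _ Φ₁.symm.contMDiff h k

/-- Pointwise form of `map_trans_comp_map_symm`: `Ψ^* ((Φ₂⁻¹)^* c) = (Φ₁⁻¹)^* c`. [cite: BottTu1982Forms, §I.2] -/
theorem complexDeRhamCohomology.map_trans_apply (Φ₁ : Diffeomorph 𝓘(ℝ, E) 𝓘(ℝ, E') M M' ∞)
    (Φ₂ : Diffeomorph 𝓘(ℝ, E) 𝓘(ℝ, E'') M M'' ∞) (k : ℕ) (c : complexDeRhamCohomology E M k) :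
    complexDeRhamCohomology.map E' (Φ₁.symm.trans Φ₂).contMDiff k (complexDeRhamCohomology.map E'' Φ₂.symm.contMDiff k c) =
      complexDeRhamCohomology.map E' Φ₁.symm.contMDiff k c :=
  LinearMap.congr_fun (complexDeRhamCohomology.map_trans_comp_map_symm Φ₁ Φ₂ k) c

/-- **Representatives of one transported class differ by an exact form after pull-back**: if `η₁` on `M'` represents
`(Φ₁⁻¹)^* c` and `η₂` on `M''` represents `(Φ₂⁻¹)^* c`, then `Ψ^* η₂ − η₁` is exact on `M'`, `Ψ = Φ₁⁻¹ ≫ Φ₂`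
(`complexDeRhamCohomology.mk_eq_mk_iff`). [cite: BottTu1982Forms, §I.2] -/
theorem pullback_trans_sub_mem_cexactSmoothForms (Φ₁ : Diffeomorph 𝓘(ℝ, E) 𝓘(ℝ, E') M M' ∞)
    (Φ₂ : Diffeomorph 𝓘(ℝ, E) 𝓘(ℝ, E'') M M'' ∞) (k : ℕ) (c : complexDeRhamCohomology E M k)
    (η₁ : cclosedSmoothForms E' M' k) (η₂ : cclosedSmoothForms E'' M'' k)
    (h₁ : complexDeRhamCohomology.mk E' M' k η₁ = complexDeRhamCohomology.map E' Φ₁.symm.contMDiff k c)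
    (h₂ : complexDeRhamCohomology.mk E'' M'' k η₂ = complexDeRhamCohomology.map E'' Φ₂.symm.contMDiff k c) :
    (η₂ : MForm 𝓘(ℝ, E'') M'' ℂ k).pullback 𝓘(ℝ, E') (Φ₁.symm.trans Φ₂) - (η₁ : MForm 𝓘(ℝ, E') M' ℂ k) ∈
      cexactSmoothForms E' M' k := by
  have hcl : complexDeRhamCohomology.mk E' M' k ⟨(η₂ : MForm 𝓘(ℝ, E'') M'' ℂ k).pullback 𝓘(ℝ, E') (Φ₁.symm.trans Φ₂),
      pullback_mem_cclosedSmoothForms (Φ₁.symm.trans Φ₂).contMDiff η₂.2⟩ = complexDeRhamCohomology.mk E' M' k η₁ := by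
    rw [← complexDeRhamCohomology.map_mk (Φ₁.symm.trans Φ₂).contMDiff, h₂, complexDeRhamCohomology.map_trans_apply, h₁]
  have h := (complexDeRhamCohomology.mk_eq_mk_iff _ _).1 hcl
  simpa using h

end Literature.Geometry.Kaehler

end
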